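import Literature.NumberTheory.EllipticCurves.EmertonPollackWeston2006.HidaFamilyTransfer
import HarnessLib

/-!
# Emerton–Pollack–Weston 2006 transfer to a multiplicative prime — projections and sources (cell `b2b-bsdres`)

HONEST FRAMING (cell `b2b-bsdres`): the cell deletes COMBINATION-SHAPED residual classes of the
rank-`≤ 1` BSD formula from PUBLISHED theorems only and types the rest; this is not "finishing BSD".

Theorems only (no definition, no new named fact; prover x11a gen 8). Companion of
`EmertonPollackWeston2006/HidaFamilyTransfer.lean` (the named facts
`cor514_transfer_of_goodOrdinary` / `cor514_transfer_of_multiplicative` and the two shapes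
`GoodOrdinaryCharIdealMuZero` / `MultiplicativeCharIdealMuZero`):
* projections of `MultiplicativeCharIdealMuZero W p` onto the input shapes of the cell's
  `p`-adic certificate engine (`Rank1Residual/Typed/PAdicCertificateEngine.lean`) — literally the
  projections of `Skinner2016.thmA_charIdeal_multiplicative` with the source replaced — and onto
  the "both inclusions + `μ = 0`" shape a rank-`0` glue consumes;
* `multiplicativeCharIdealMuZero_of_thmA`: a (ram) curve is a legitimate SOURCE of
  `cor514_transfer_of_multiplicative` — Skinner 2016 Thm. A (PUBLISHED, (ram) locus) plus the finite
  certificate "`μ^an = 0`" (an explicit binder) give the multiplicative shape;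
* `goodOrdinaryCharIdealMuZero_of_shape`: the good-ordinary shape is, binder for binder, the
  `E₁`-hypothesis / `E₂`-conclusion of the Greenberg–Vatsal Thm. (1.4) fact of `GreenbergVatsal2000/CongruentCurves.lean`,
  so any supplier of that shape (e.g. the Rubin ∘ Greenberg–Vatsal composition of `GreenbergVatsal2000/CongruentCurves.lean` (route U1′)) is an
  admissible SOURCE of `cor514_transfer_of_goodOrdinary`.

References: [EmertonPollackWeston2006] Cor. 5.1.4, Thm. 5.1.3 (arXiv:math/0404484 p. 30);
[Skinner2016PacificMC] Thm. A, §3.2, §3.3; [GreenbergVatsal2000] Thm. (1.4).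
-/

set_option autoImplicit false

noncomputable section

open scoped Classical MatrixGroups ModularForm

open CongruenceSubgroup WeierstrassCurve Literature.NumberTheory.EllipticCurves
  Literature.NumberTheory.EllipticCurves.ModularForms
  Literature.NumberTheory.EllipticCurves.GreenbergVatsal2000

namespace Literature.NumberTheory.EllipticCurves.EmertonPollackWeston2006

/-! ### Projections of the multiplicative shape (the inputs of the `p`-adic certificate engine) -/

namespace MultiplicativeCharIdealMuZero

variable {W : WeierstrassCurve ℚ} [W.IsElliptic] [W.IsGloballyMinimal] {p : ℕ} [Fact p.Prime]

/-- First clause: `X(E/ℚ_∞)` is a torsion `Λ`-module. [cite: EmertonPollackWeston2006, Thm. 3.1.1 (arXiv p. 17)] -/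
theorem isTorsion (hMC : MultiplicativeCharIdealMuZero W p)
    {κ : ZpExtension ℚ p} {γ : Field.absoluteGaloisGroup ℚ} {N : ℕ} [NeZero N]
    {f : CuspForm (Gamma0 N) 2} (hκ : κ.IsCyclotomic) (hγ : κ.IsTopGenerator γ)
    (hγ' : IsCyclotomicVariable p γ) (hf : IsNewformOf W f) (D : W.SelmerDualData κ γ) (ϖ : ℚ)
    (hϖ0 : ϖ ≠ 0) (hϖ : (ϖ : ℝ) * W.realPeriodRat = plusPeriod f) : D.IsTorsion :=
  (hMC κ γ f hκ hγ hγ' hf D ϖ hϖ0 hϖ).1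

/-- `μ = 0`: a generator of `char_Λ X(E/ℚ_∞)` with unit content.
[cite: EmertonPollackWeston2006, Thm. 5.1.3 (arXiv p. 30)] -/
theorem exists_charIdeal_eq_span_hasUnitContent (hMC : MultiplicativeCharIdealMuZero W p)
    {κ : ZpExtension ℚ p} {γ : Field.absoluteGaloisGroup ℚ} {N : ℕ} [NeZero N]
    {f : CuspForm (Gamma0 N) 2} (hκ : κ.IsCyclotomic) (hγ : κ.IsTopGenerator γ)
    (hγ' : IsCyclotomicVariable p γ) (hf : IsNewformOf W f) (D : W.SelmerDualData κ γ) (ϖ : ℚ)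
    (hϖ0 : ϖ ≠ 0) (hϖ : (ϖ : ℝ) * W.realPeriodRat = plusPeriod f) :
    ∃ g : IwasawaAlgebra p, D.charIdeal = Ideal.span {g} ∧ HasUnitContent g := by
  obtain ⟨-, g, hchar, hμ, -⟩ := hMC κ γ f hκ hγ hγ' hf D ϖ hϖ0 hϖ
  exact ⟨g, hchar, hμ⟩

/-- **Split multiplicative `p`: the shape of the `p`-adic certificate engine** — a generator `fE`
of `char_Λ X(E/ℚ_∞)`, an element `g ∈ (fE)` and `ϖ · L = T¹ · ι(g)` (input `hι` of
`Typed.padicValNat_card_shaPrimary_le_of_leadingTerm_shape` with `e = 1`, `c = ϖ`); literally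
`Skinner2016.thmA_charIdeal_multiplicative.exists_engine_shape_split` with the source replaced.
[cite: EmertonPollackWeston2006, Cor. 5.1.4 (arXiv p. 30)] -/
theorem exists_engine_shape_split (hMC : MultiplicativeCharIdealMuZero W p)
    {κ : ZpExtension ℚ p} {γ : Field.absoluteGaloisGroup ℚ} {N : ℕ} [NeZero N]
    {f : CuspForm (Gamma0 N) 2} (hκ : κ.IsCyclotomic) (hγ : κ.IsTopGenerator γ)
    (hγ' : IsCyclotomicVariable p γ) (hf : IsNewformOf W f) (D : W.SelmerDualData κ γ) (ϖ : ℚ)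
    (hϖ0 : ϖ ≠ 0) (hϖ : (ϖ : ℝ) * W.realPeriodRat = plusPeriod f) (hsplit : W.HasSplitMultiplicativeReductionAtPrime p)
    (L : PowerSeries ℚ_[p]) (hL : IsSplitMultPAdicLFunctionOf f p L) :
    ∃ fE g : IwasawaAlgebra p, D.charIdeal = Ideal.span {fE} ∧ g ∈ Ideal.span {fE} ∧
      PowerSeries.C ((ϖ : ℚ) : ℚ_[p]) * L = PowerSeries.X ^ 1 * iwasawaToPowerSeries p g := by
  obtain ⟨-, fE, hchar, -, hsp, -⟩ := hMC κ γ f hκ hγ hγ' hf D ϖ hϖ0 hϖ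
  obtain ⟨w, hw⟩ := hsp hsplit L hL
  refine ⟨fE, fE * w, hchar, Ideal.mem_span_singleton'.mpr ⟨(w : IwasawaAlgebra p), mul_comm _ _⟩, ?_⟩
  rw [← hw, mul_assoc, map_mul, pow_one]
  simp [iwasawaToPowerSeries, PowerSeries.map_X]

/-- **Non-split multiplicative `p`: the engine's shape** (`e = 0`, `c = ϖ`).
[cite: EmertonPollackWeston2006, Cor. 5.1.4 (arXiv p. 30)] -/
theorem exists_engine_shape_nonsplit (hMC : MultiplicativeCharIdealMuZero W p)
    {κ : ZpExtension ℚ p} {γ : Field.absoluteGaloisGroup ℚ} {N : ℕ} [NeZero N]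
    {f : CuspForm (Gamma0 N) 2} (hκ : κ.IsCyclotomic) (hγ : κ.IsTopGenerator γ)
    (hγ' : IsCyclotomicVariable p γ) (hf : IsNewformOf W f) (D : W.SelmerDualData κ γ) (ϖ : ℚ)
    (hϖ0 : ϖ ≠ 0) (hϖ : (ϖ : ℝ) * W.realPeriodRat = plusPeriod f) (hns : ¬ W.HasSplitMultiplicativeReductionAtPrime p)
    (L : PowerSeries ℚ_[p]) (hL : IsMultPAdicLFunctionOf f p (-1) L) :
    ∃ fE g : IwasawaAlgebra p, D.charIdeal = Ideal.span {fE} ∧ g ∈ Ideal.span {fE} ∧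
      PowerSeries.C ((ϖ : ℚ) : ℚ_[p]) * L = PowerSeries.X ^ 0 * iwasawaToPowerSeries p g := by
  obtain ⟨-, fE, hchar, -, -, hnsp⟩ := hMC κ γ f hκ hγ hγ' hf D ϖ hϖ0 hϖ
  obtain ⟨w, hw⟩ := hnsp hns L hL
  exact ⟨fE, fE * w, hchar, Ideal.mem_span_singleton'.mpr ⟨(w : IwasawaAlgebra p), mul_comm _ _⟩,
    by rw [← hw, pow_zero, one_mul]⟩

/-- **Split multiplicative `p`: BOTH inclusions** — `char_Λ X = (fE)`, `μ(fE) = 0` and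
`ι(T · fE · w) = ϖ · L` with `w` a unit (the equality a rank-`0` glue consumes).
[cite: EmertonPollackWeston2006, Cor. 5.1.4 (arXiv p. 30)] -/
theorem exists_charIdeal_eq_unit_split (hMC : MultiplicativeCharIdealMuZero W p)
    {κ : ZpExtension ℚ p} {γ : Field.absoluteGaloisGroup ℚ} {N : ℕ} [NeZero N]
    {f : CuspForm (Gamma0 N) 2} (hκ : κ.IsCyclotomic) (hγ : κ.IsTopGenerator γ)
    (hγ' : IsCyclotomicVariable p γ) (hf : IsNewformOf W f) (D : W.SelmerDualData κ γ) (ϖ : ℚ)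
    (hϖ0 : ϖ ≠ 0) (hϖ : (ϖ : ℝ) * W.realPeriodRat = plusPeriod f) (hsplit : W.HasSplitMultiplicativeReductionAtPrime p)
    (L : PowerSeries ℚ_[p]) (hL : IsSplitMultPAdicLFunctionOf f p L) :
    ∃ (fE : IwasawaAlgebra p) (w : (IwasawaAlgebra p)ˣ), D.charIdeal = Ideal.span {fE} ∧
      HasUnitContent fE ∧
      iwasawaToPowerSeries p ((PowerSeries.X : IwasawaAlgebra p) * fE * (w : IwasawaAlgebra p)) =
        PowerSeries.C ((ϖ : ℚ) : ℚ_[p]) * L := by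
  obtain ⟨-, fE, hchar, hμ, hsp, -⟩ := hMC κ γ f hκ hγ hγ' hf D ϖ hϖ0 hϖ
  obtain ⟨w, hw⟩ := hsp hsplit L hL
  exact ⟨fE, w, hchar, hμ, hw⟩

/-- **Non-split multiplicative `p`: BOTH inclusions** — `char_Λ X = (fE)`, `μ(fE) = 0` and
`ι(fE · w) = ϖ · L`. [cite: EmertonPollackWeston2006, Cor. 5.1.4 (arXiv p. 30)] -/
theorem exists_charIdeal_eq_unit_nonsplit (hMC : MultiplicativeCharIdealMuZero W p)
    {κ : ZpExtension ℚ p} {γ : Field.absoluteGaloisGroup ℚ} {N : ℕ} [NeZero N]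
    {f : CuspForm (Gamma0 N) 2} (hκ : κ.IsCyclotomic) (hγ : κ.IsTopGenerator γ)
    (hγ' : IsCyclotomicVariable p γ) (hf : IsNewformOf W f) (D : W.SelmerDualData κ γ) (ϖ : ℚ)
    (hϖ0 : ϖ ≠ 0) (hϖ : (ϖ : ℝ) * W.realPeriodRat = plusPeriod f) (hns : ¬ W.HasSplitMultiplicativeReductionAtPrime p)
    (L : PowerSeries ℚ_[p]) (hL : IsMultPAdicLFunctionOf f p (-1) L) :
    ∃ (fE : IwasawaAlgebra p) (w : (IwasawaAlgebra p)ˣ), D.charIdeal = Ideal.span {fE} ∧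
      HasUnitContent fE ∧
      iwasawaToPowerSeries p (fE * (w : IwasawaAlgebra p)) = PowerSeries.C ((ϖ : ℚ) : ℚ_[p]) * L := by
  obtain ⟨-, fE, hchar, hμ, -, hnsp⟩ := hMC κ γ f hκ hγ hγ' hf D ϖ hϖ0 hϖ
  obtain ⟨w, hw⟩ := hnsp hns L hL
  exact ⟨fE, w, hchar, hμ, hw⟩

end MultiplicativeCharIdealMuZero

/-! ### A (ram) curve as a SOURCE: Skinner 2016 Thm. A plus the certificate `μ^an = 0` -/

/-- **The multiplicative shape from Skinner 2016 Thm. A on the (ram) locus, given the finite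
certificate "`μ = 0`".** For `W` globally minimal, `3 ≤ p` multiplicative, `E[p]` irreducible and a
ramified multiplicative `ℓ ≠ p` (`Skinner2016.thmA_charIdeal_multiplicative`, PUBLISHED), Theorem A
gives `char X = (g)` and `ι(T^e · g · w) = ϖ · L`; the EXPLICIT binder `hμ` — for the newform, the
period ratio and THE `p`-adic `L`-function, some coefficient of `ϖ · L` is a `p`-adic unit (one exact
modular-symbol computation per curve; not a published theorem and not asserted here) — is then
`HasUnitContent g` (`hasUnitContent_iff_exists_norm_coeff_map_eq_one`, the factor `T^e · w` being
harmless). So a (ram) curve is a legitimate source `E₁` of `cor514_transfer_of_multiplicative`.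
[cite: Skinner2016PacificMC, Thm. A (§1), §3.2, §3.3] [cite: EmertonPollackWeston2006, Cor. 5.1.4 (arXiv p. 30)] -/
theorem multiplicativeCharIdealMuZero_of_thmA (hA : Skinner2016.thmA_charIdeal_multiplicative)
    (W : WeierstrassCurve ℚ) [W.IsElliptic] [W.IsGloballyMinimal] (p : ℕ) [Fact p.Prime]
    (hp : 3 ≤ p) (hmult : W.HasMultiplicativeReductionAtPrime p)
    (hirr : W.HasIrreducibleModPGaloisRep p)
    (hram : ∃ ℓ : ℕ, ∃ _ : Fact ℓ.Prime, ℓ ≠ p ∧ W.HasMultiplicativeReductionAtPrime ℓ ∧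
      ¬ p ∣ padicValInt ℓ W.minimalDiscriminantInt)
    (hμ : ∀ {N : ℕ} [NeZero N] (f : CuspForm (Gamma0 N) 2), IsNewformOf W f →
      ∀ (ϖ : ℚ), ϖ ≠ 0 → (ϖ : ℝ) * W.realPeriodRat = plusPeriod f →
        (W.HasSplitMultiplicativeReductionAtPrime p →
          ∃ L : PowerSeries ℚ_[p], IsSplitMultPAdicLFunctionOf f p L ∧
            ∃ n : ℕ, ‖PowerSeries.coeff n (PowerSeries.C ((ϖ : ℚ) : ℚ_[p]) * L)‖ = 1) ∧
        (¬ W.HasSplitMultiplicativeReductionAtPrime p →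
          ∃ L : PowerSeries ℚ_[p], IsMultPAdicLFunctionOf f p (-1) L ∧
            ∃ n : ℕ, ‖PowerSeries.coeff n (PowerSeries.C ((ϖ : ℚ) : ℚ_[p]) * L)‖ = 1)) :
    MultiplicativeCharIdealMuZero W p := by
  intro κ γ N _ f hκ hγ hγ' hf D ϖ hϖ0 hϖ
  obtain ⟨htors, g, hchar, hsp, hnsp⟩ := hA W p hp hmult hirr hram hκ hγ hγ' hf D ϖ hϖ0 hϖ
  refine ⟨htors, g, hchar, ?_, hsp, hnsp⟩
  by_cases hsplit : W.HasSplitMultiplicativeReductionAtPrime p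
  · obtain ⟨L, hL, n, hn⟩ := (hμ f hf ϖ hϖ0 hϖ).1 hsplit
    obtain ⟨w, hw⟩ := hsp hsplit L hL
    rw [← hasUnitContent_X_mul_mul_unit_iff g w, hasUnitContent_iff_exists_norm_coeff_map_eq_one, hw]
    exact ⟨n, hn⟩
  · obtain ⟨L, hL, n, hn⟩ := (hμ f hf ϖ hϖ0 hϖ).2 hsplit
    obtain ⟨w, hw⟩ := hnsp hsplit L hL
    rw [← hasUnitContent_mul_unit_iff g w, hasUnitContent_iff_exists_norm_coeff_map_eq_one, hw]
    exact ⟨n, hn⟩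

/-- **Bookkeeping twin of the Greenberg–Vatsal Thm. (1.4) fact's shape**: the good-ordinary shape of this
file is, binder for binder, the `E₁`-hypothesis of the Greenberg–Vatsal transfer — so the OUTPUT of
the Rubin ∘ Greenberg–Vatsal composition of `GreenbergVatsal2000/CongruentCurves.lean` (route U1′) (Rubin's CM theorem 12.3 moved along a
congruence) or of any other supplier of that shape is an admissible SOURCE here. [folklore] -/
theorem goodOrdinaryCharIdealMuZero_of_shape (W : WeierstrassCurve ℚ) [W.IsElliptic]
    [W.IsGloballyMinimal] (p : ℕ) [Fact p.Prime]
    (h : ∀ (κ : ZpExtension ℚ p) (γ : Field.absoluteGaloisGroup ℚ),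
        κ.IsCyclotomic → κ.IsTopGenerator γ → IsCyclotomicVariable p γ →
      ∀ [NeZero (W.conductorNorm ℤ)] (f : CuspForm (Gamma0 (W.conductorNorm ℤ)) 2),
        IsNewformOf W f → ∀ (ϖ : ℚ), (ϖ : ℝ) * W.realPeriodRat = plusPeriod f →
      ∀ (D : W.SelmerDualData κ γ), D.IsTorsion ∧
        ∃ g : IwasawaAlgebra p, D.charIdeal = Ideal.span {g} ∧ HasUnitContent g ∧
          iwasawaToPowerSeries p g =
            PowerSeries.C (ϖ : ℚ_[p]) * padicLFunction f (unitRoot W p : ℚ_[p])) :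
    GoodOrdinaryCharIdealMuZero W p :=
  h


end Literature.NumberTheory.EllipticCurves.EmertonPollackWeston2006

end
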